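import Summits.QuantumFields.YangMills.Theorems.FluctuationComparisonRegPrIntLPersistenceSigmaFree
import Summits.QuantumFields.YangMills.Theorems.FluctuationComparisonRegPrIntLSmallMassOneStep
import Summits.QuantumFields.YangMills.Theorems.FluctuationComparisonRegPrIntLHaarFloorDepthOne
import Summits.QuantumFields.YangMills.Theorems.FluctuationComparisonRegPrIntLHaarTubeLocalCharge
import HarnessLib

/-!
# `FluctuationComparisonRegPrIntLPersistenceKFree` — PERS₁∘ FROM THE TWO K-UNIFORM DENSITY LETTERS AND ONE K-FREE TUBE LETTER: the σ-free persistence road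
# assembled BY NAME (crux `FluctuationComparisonRegPrIntL`, stmt-QuantumFields-20520; LINE g22-4 ∕ g22-5, row PERS₁∘ `OneLevelPersistenceIntCan`)

Cell `ym3-torus` (YM ladder rung R3 = continuum SU(2) Yang–Mills on T³ — a RUNG, NOT d = 4, NOT infinite volume, NOT a mass gap, NOT Clay);
width seat `ym3-torus-px8` (gen 14), explicit-unit helper; `--supports stmt-QuantumFields-20520 --as helper`.  THEOREMS ONLY (0 `def`, 0 `sorry`,
default heartbeats).

WHAT.  Composition of three landed doors: LEAD w3-20520 g18's ✓`…PersistenceSigmaFree.oneLevelPersistenceIntCan_of_up_low_smallMass` (p764726: ⟨UP⟩ + ⟨LOW on S′⟩ +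
⟨SMALL-MASS₁(S′)⟩ ⇒ PERS₁∘ verbatim), px8 g14's ✓`…SmallMassOneStep.smallMassInterior_of_haarTubeRel_floor` (p764821: GEOM∘ ✓ + ⟨HAAR-TUBE₁-REL⟩ + ⟨FLOOR₁⟩ ⇒
⟨SMALL-MASS₁(S′)⟩) and px20 g11's UNCONDITIONAL ✓`…HaarFloorDepthOne.haarFloor_histGood_depthOne` (p764768: ⟨FLOOR₁⟩).  RESULT:
★★★ `oneLevelPersistenceIntCan_of_up_low_haarTubeRel : ⟨UP⟩ + ⟨LOW on S′⟩ (one bundle, the §6 letters WITHOUT the small-mass clause) → ⟨HAAR-TUBE₁-REL (margin sections)⟩ →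
PERS₁∘ VERBATIM` — so, by name, PERS₁∘ ⟸ {⟨UP⟩, ⟨LOW⟩} ([Balaban1985UV3] (7) at height `K − J − 1`, `K`-UNIFORM, nobody's) + ONE `K`-FREE kinematic letter
⟨HAAR-TUBE₁-REL⟩, whose chart road is typed end to end (✓p764111 ∕ ✓p764434 door, ✓p764381 engine, px20 g11's point charge ⧗) — the moment the point charge lands,
PERS₁∘ ⟸ ⟨UP⟩ + ⟨LOW⟩ ALONE.  Prefix merge: `c₀ := min`, `pS := max`, `γ₁ := min`.
§2 (v1.1) THE CLOSING COROLLARIES, with px20 g11's UNCONDITIONAL ✓`…HaarTubeLocalCharge.haarTubeRel_depthOne` (⟨HAAR-TUBE₁-REL⟩ at depth one) plugged in: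
★★★ `smallMassInterior` — ⟨SMALL-MASS₁(S′)⟩ HYPOTHESIS-FREE; ★★★★ `oneLevelPersistenceIntCan_of_up_low` — PERS₁∘ ⟸ ⟨UP⟩ + ⟨LOW on S′⟩ ONLY: the K-free side of the
persistence row is CLOSED by kernel; what PERS₁∘ owes is exactly Bałaban's K-uniform two-sided density bounds at height `K − J − 1` ([Balaban1985UV3] (5)–(7)).

HONEST SCOPE.  A knit by name; ⟨UP⟩, ⟨LOW⟩ (K-uniform, XL) and ⟨HAAR-TUBE₁-REL⟩ (K-free, its point charge pending) are HYPOTHESES; PERS₁∘, POS∘, LFR♯ᶜ∘, S2β, the crux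
20520 and every rung statement are NOT proved; `YM3TorusSU2` NOT proved; the Yang–Mills mass gap (Clay) NOT proved.

References: T. Bałaban, Commun. Math. Phys. **102** (1985) 255–275 [Balaban1985UV3] ((7) p. 257, (38)–(40) p. 266); CMP **98** (1985) 17–51 [Balaban1985Averaging]
((10) p. 19, Prop. 1 p. 22); CMP **109** (1987) 249–301 [Balaban1987RG1] ((0.18)–(0.22) p. 255).
-/

set_option autoImplicit false

noncomputable section

open MeasureTheory Set
open scoped ENNReal NNReal
open Literature.MathematicalPhysics.QuantumFieldTheory.Balaban1983to89
open Literature.MathematicalPhysics.QuantumFieldTheory.Balaban1983to89.T3ContinuumYM3Torus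
open Literature.MathematicalPhysics.QuantumFieldTheory.Balaban1983to89.T3UnitLawDensityEML
open Literature.MathematicalPhysics.QuantumFieldTheory.Balaban1983to89.T3UnitScaleTilt
open Literature.MathematicalPhysics.QuantumFieldTheory.Balaban1983to89.T3TiltDescent
open Summit.QuantumFields.YangMills.Theorems.FluctuationComparisonRegPrIntLPersistenceSigmaFree (oneLevelPersistenceIntCan_of_up_low_smallMass)
open Summit.QuantumFields.YangMills.Theorems.FluctuationComparisonRegPrIntLSmallMassOneStep (smallMassInterior_of_haarTubeRel_floor)
open Summit.QuantumFields.YangMills.Theorems.FluctuationComparisonRegPrIntLHaarFloorDepthOne (haarFloor_histGood_depthOne)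
open Summit.QuantumFields.YangMills.Theorems.FluctuationComparisonRegPrIntLHaarTubeLocalCharge (haarTubeRel_depthOne)

namespace Summit.QuantumFields.YangMills.Theorems.FluctuationComparisonRegPrIntLPersistenceKFree

/-! ## §1 The assembly with ⟨HAAR-TUBE₁-REL⟩ displayed -/

/-- ★★★ **PERS₁∘ ⟸ ⟨UP⟩ + ⟨LOW on S′⟩ + ⟨HAAR-TUBE₁-REL⟩** (the σ-free road assembled by name; GEOM∘ ✓p763878 and ⟨FLOOR₁⟩ ✓p764768 enter as theorems of the tree).
`hUL`: in PERS₁∘'s prefix, for every `J`, constants `C, cl > 0` with, for every run `K ≥ J+1`, ⟨UP⟩ `ν_K⌊D⁻¹W_J(c·b₀) ≤ C·dU_{J+1}⌊D⁻¹W_J(c·b₀)` and ⟨LOW⟩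
`cl·dU_{J+1}⌊S′ ≤ ν_K⌊S′` (`ν_K := (gibbsK K).map D_{J+1,K}`, `S′ := {PlaqSmall θ_{J+1}(c·b₀)}` — EXACTLY the two measure letters of ✓p764726's hypothesis); `hrel`: the
`Sfine`-relative one-step Haar tube charge for measurable margin sections (✓p764821's `hrel`, px20 g11's LOCAL target).  CONCLUSION: PERS₁∘ `OneLevelPersistenceIntCan`
VERBATIM.  HONEST SCOPE: ⟨UP⟩∕⟨LOW⟩ = [Balaban1985UV3] (7), K-uniform, NOT proved; ⟨HAAR-TUBE₁-REL⟩'s point charge NOT proved; PERS₁∘, 20520 NOT proved.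
[cite: Balaban1985UV3, (7) p.257 and (38)-(40) p.266; Balaban1985Averaging, (10) p.19 and Prop. 1 p.22; Balaban1987RG1, (0.18)-(0.22) p.255] -/
theorem oneLevelPersistenceIntCan_of_up_low_haarTubeRel
    (hUL : ∀ (L : ℕ), ∃ c₀ : ℝ, 0 < c₀ ∧ c₀ ≤ 1 ∧ ∀ (c : ℝ), 0 < c → c ≤ c₀ → ∃ pS : ℝ, ∀ (b₀ p₀ : ℝ), 0 < b₀ → pS ≤ p₀ → 0 < p₀ →
      ∃ γ₁ : ℝ, 0 < γ₁ ∧ ∀ (F : T3Family) (γ : ℝ), F.L = L → 0 < γ → γ ≤ γ₁ →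
        ∀ (J : ℕ), ∃ C cl : ℝ, 0 < C ∧ 0 < cl ∧ ∀ (K : ℕ) (hJK : J + 1 ≤ K),
          ((gibbsK F ℰp γ K).map (descendTo F ℰp (J + 1) K hJK)).restrict
              (descendTo F ℰp J (J + 1) (Nat.le_succ J) ⁻¹' {U | PlaqSmall (θBal F.L γ (c * b₀) p₀ J) U}) ≤
            ENNReal.ofReal C • (fieldMeasure (F.P (J + 1)) 0 (Matrix.specialUnitaryGroup (Fin 2) ℂ)).restrict
              (descendTo F ℰp J (J + 1) (Nat.le_succ J) ⁻¹' {U | PlaqSmall (θBal F.L γ (c * b₀) p₀ J) U}) ∧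
          ENNReal.ofReal cl • (fieldMeasure (F.P (J + 1)) 0 (Matrix.specialUnitaryGroup (Fin 2) ℂ)).restrict
              {V | PlaqSmall (θBal F.L γ (c * b₀) p₀ (J + 1)) V} ≤
            ((gibbsK F ℰp γ K).map (descendTo F ℰp (J + 1) K hJK)).restrict {V | PlaqSmall (θBal F.L γ (c * b₀) p₀ (J + 1)) V})
    (hrel : ∀ (L : ℕ), ∃ c₀ : ℝ, 0 < c₀ ∧ c₀ ≤ 1 ∧ ∀ (c : ℝ), 0 < c → c ≤ c₀ → ∃ pS : ℝ, ∀ (b₀ p₀ : ℝ), 0 < b₀ → pS ≤ p₀ → 0 < p₀ →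
      ∃ γ₁ : ℝ, 0 < γ₁ ∧ ∀ (F : T3Family) (γ : ℝ), F.L = L → 0 < γ → γ ≤ γ₁ →
        ∀ (J : ℕ) (r : ℝ), 0 < r →
          ∀ σ : GaugeField (F.P J) 0 (Matrix.specialUnitaryGroup (Fin 2) ℂ) → GaugeField (F.P (J + 1)) 0 (Matrix.specialUnitaryGroup (Fin 2) ℂ),
            Measurable σ →
            (∀ U : GaugeField (F.P J) 0 (Matrix.specialUnitaryGroup (Fin 2) ℂ), PlaqSmall (θBal F.L γ (c * b₀) p₀ J) U →
              descendTo F ℰp J (J + 1) (Nat.le_succ J) (σ U) = U ∧ PlaqSmall (θBal F.L γ (c * b₀) p₀ (J + 1) - 4 * r) (σ U)) →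
            ∃ q₁ : ℝ, 0 < q₁ ∧ ∀ (B : Set (GaugeField (F.P J) 0 (Matrix.specialUnitaryGroup (Fin 2) ℂ))), MeasurableSet B →
              B ⊆ {U | PlaqSmall (θBal F.L γ (c * b₀) p₀ J) U} →
              ENNReal.ofReal q₁ * fieldMeasure (F.P (J + 1)) 0 (Matrix.specialUnitaryGroup (Fin 2) ℂ)
                  (descendTo F ℰp J (J + 1) (Nat.le_succ J) ⁻¹' B ∩ histGood F ℰp (θBal F.L γ b₀ p₀) (J + 1) J) ≤
                fieldMeasure (F.P (J + 1)) 0 (Matrix.specialUnitaryGroup (Fin 2) ℂ)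
                  (descendTo F ℰp J (J + 1) (Nat.le_succ J) ⁻¹' B ∩ histGood F ℰp (θBal F.L γ b₀ p₀) (J + 1) J ∩
                    {V | ∀ b : PBond (F.P (J + 1)) 0, dist1 ((σ (descendTo F ℰp J (J + 1) (Nat.le_succ J) V) b)⁻¹ * V b) < r})) :
    ∀ (L : ℕ), ∃ c₀ : ℝ, 0 < c₀ ∧ c₀ ≤ 1 ∧ ∀ (c : ℝ), 0 < c → c ≤ c₀ → ∃ pS : ℝ, ∀ (b₀ p₀ : ℝ), 0 < b₀ → pS ≤ p₀ → 0 < p₀ →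
      ∃ γ₁ : ℝ, 0 < γ₁ ∧ ∀ (F : T3Family) (γ : ℝ), F.L = L → 0 < γ → γ ≤ γ₁ →
        ∀ (J : ℕ), ∃ q : ℝ, 0 < q ∧ ∀ (K : ℕ) (hJK : J + 1 ≤ K)
          (B : Set (GaugeField (F.P J) 0 (Matrix.specialUnitaryGroup (Fin 2) ℂ))), MeasurableSet B →
            B ⊆ {U | PlaqSmall (θBal F.L γ (c * b₀) p₀ J) U} →
            ENNReal.ofReal q * gibbsK F ℰp γ K (descendTo F ℰp J K ((Nat.le_succ J).trans hJK) ⁻¹' B) ≤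
              gibbsK F ℰp γ K (descendTo F ℰp J K ((Nat.le_succ J).trans hJK) ⁻¹' B ∩
                descendTo F ℰp (J + 1) K hJK ⁻¹' {V | PlaqSmall (θBal F.L γ (c * b₀) p₀ (J + 1)) V}) := by
  -- ⟨SMALL-MASS₁(S′)⟩ from the tube road (GEOM∘ and ⟨FLOOR₁⟩ by name)
  have hSM := smallMassInterior_of_haarTubeRel_floor hrel haarFloor_histGood_depthOne
  -- merge the two prefixes and feed the σ-free knit
  refine oneLevelPersistenceIntCan_of_up_low_smallMass fun L => ?_
  obtain ⟨c₀U, hc₀U, hc₀U1, hU⟩ := hUL L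
  obtain ⟨c₀S, hc₀S, -, hS⟩ := hSM L
  refine ⟨min c₀U c₀S, lt_min hc₀U hc₀S, (min_le_left _ _).trans hc₀U1, fun c hc hcle => ?_⟩
  obtain ⟨pSU, hU⟩ := hU c hc (hcle.trans (min_le_left _ _))
  obtain ⟨pSS, hS⟩ := hS c hc (hcle.trans (min_le_right _ _))
  refine ⟨max pSU pSS, fun b₀ p₀ hb₀ hpS hp₀ => ?_⟩
  obtain ⟨γU, hγU, hU⟩ := hU b₀ p₀ hb₀ ((le_max_left _ _).trans hpS) hp₀
  obtain ⟨γS, hγS, hS⟩ := hS b₀ p₀ hb₀ ((le_max_right _ _).trans hpS) hp₀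
  refine ⟨min γU γS, lt_min hγU hγS, fun F γ hFL hγ hγle J => ?_⟩
  exact ⟨hU F γ hFL hγ (hγle.trans (min_le_left _ _)) J, hS F γ hFL hγ (hγle.trans (min_le_right _ _)) J⟩

/-! ## §2 (v1.1) The closing corollaries: ⟨SMALL-MASS₁(S′)⟩ hypothesis-free; PERS₁∘ from ⟨UP⟩ + ⟨LOW⟩ alone -/

/-- ★★★ **⟨SMALL-MASS₁(S′)⟩, HYPOTHESIS-FREE**: for every `L` there are `c₀ ∈ (0,1]`, …, such that for every family (`F.L = L`), `0 < γ ≤ γ₁` and level `J` there is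
`q₀ > 0` with `ofReal q₀·dU_{J+1}(D⁻¹B) ≤ dU_{J+1}(D⁻¹B ∩ {PlaqSmall θ_{J+1}(c·b₀)})` for every measurable `B ⊆ W_J(c·b₀)` — the one-step Haar fibre over interior
data charges the next interior window.  ✓`smallMassInterior_of_haarTubeRel_floor` (p764821) at px20 g11's ✓`haarTubeRel_depthOne` and ✓`haarFloor_histGood_depthOne`
(p764768); behind them GEOM∘ ✓p763878, the chart door ✓p764111, w4-20520 g18's l.s.c.-floor engine ✓p764381∕p764834 and the WREG charts.  Pure one-step kinematics of
the exp-mean-log averaging on `SU(2)`; no renormalisation-group estimate. [cite: Balaban1985Averaging, (10) p.19 and Prop. 1 p.22; Balaban1987RG1, (0.4) p.253 and (0.18) p.255] -/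
theorem smallMassInterior :
    ∀ (L : ℕ), ∃ c₀ : ℝ, 0 < c₀ ∧ c₀ ≤ 1 ∧ ∀ (c : ℝ), 0 < c → c ≤ c₀ → ∃ pS : ℝ, ∀ (b₀ p₀ : ℝ), 0 < b₀ → pS ≤ p₀ → 0 < p₀ →
      ∃ γ₁ : ℝ, 0 < γ₁ ∧ ∀ (F : T3Family) (γ : ℝ), F.L = L → 0 < γ → γ ≤ γ₁ →
        ∀ (J : ℕ), ∃ q₀ : ℝ, 0 < q₀ ∧ ∀ (B : Set (GaugeField (F.P J) 0 (Matrix.specialUnitaryGroup (Fin 2) ℂ))), MeasurableSet B →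
          B ⊆ {U | PlaqSmall (θBal F.L γ (c * b₀) p₀ J) U} →
          ENNReal.ofReal q₀ * fieldMeasure (F.P (J + 1)) 0 (Matrix.specialUnitaryGroup (Fin 2) ℂ) (descendTo F ℰp J (J + 1) (Nat.le_succ J) ⁻¹' B) ≤
            fieldMeasure (F.P (J + 1)) 0 (Matrix.specialUnitaryGroup (Fin 2) ℂ) (descendTo F ℰp J (J + 1) (Nat.le_succ J) ⁻¹' B ∩
              {V | PlaqSmall (θBal F.L γ (c * b₀) p₀ (J + 1)) V}) :=
  smallMassInterior_of_haarTubeRel_floor haarTubeRel_depthOne haarFloor_histGood_depthOne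

/-- ★★★★ **PERS₁∘ ⟸ ⟨UP⟩ + ⟨LOW on S′⟩ ALONE** — the K-free side of the persistence row CLOSED: given, in PERS₁∘'s prefix, for every `J` constants `C, cl > 0` with the
two K-UNIFORM density letters of the run-`K` law of level `J+1` against product Haar — ⟨UP⟩ on `D⁻¹W_J(c·b₀)` and ⟨LOW⟩ on the level-`(J+1)` interior window
([Balaban1985UV3] (5)–(7) at height `K − J − 1`; LEAD w3-20520 g18's ⧗`…PersistenceFromHeightwiseBounds` names them against lit `T3HeightwiseDensityBounds`) — PERS₁∘
`OneLevelPersistenceIntCan` holds VERBATIM.  (§1 at ✓`haarTubeRel_depthOne`.)  HONEST SCOPE: ⟨UP⟩∕⟨LOW⟩ NOT proved; PERS₁∘, POS∘, LFR♯ᶜ∘, S2β, 20520 NOT proved.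
[cite: Balaban1985UV3, (7) p.257 and (38)-(40) p.266; Balaban1987RG1, (0.18)-(0.22) p.255; Balaban1985Averaging, Prop. 1 p.22] -/
theorem oneLevelPersistenceIntCan_of_up_low
    (hUL : ∀ (L : ℕ), ∃ c₀ : ℝ, 0 < c₀ ∧ c₀ ≤ 1 ∧ ∀ (c : ℝ), 0 < c → c ≤ c₀ → ∃ pS : ℝ, ∀ (b₀ p₀ : ℝ), 0 < b₀ → pS ≤ p₀ → 0 < p₀ →
      ∃ γ₁ : ℝ, 0 < γ₁ ∧ ∀ (F : T3Family) (γ : ℝ), F.L = L → 0 < γ → γ ≤ γ₁ →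
        ∀ (J : ℕ), ∃ C cl : ℝ, 0 < C ∧ 0 < cl ∧ ∀ (K : ℕ) (hJK : J + 1 ≤ K),
          ((gibbsK F ℰp γ K).map (descendTo F ℰp (J + 1) K hJK)).restrict
              (descendTo F ℰp J (J + 1) (Nat.le_succ J) ⁻¹' {U | PlaqSmall (θBal F.L γ (c * b₀) p₀ J) U}) ≤
            ENNReal.ofReal C • (fieldMeasure (F.P (J + 1)) 0 (Matrix.specialUnitaryGroup (Fin 2) ℂ)).restrict
              (descendTo F ℰp J (J + 1) (Nat.le_succ J) ⁻¹' {U | PlaqSmall (θBal F.L γ (c * b₀) p₀ J) U}) ∧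
          ENNReal.ofReal cl • (fieldMeasure (F.P (J + 1)) 0 (Matrix.specialUnitaryGroup (Fin 2) ℂ)).restrict
              {V | PlaqSmall (θBal F.L γ (c * b₀) p₀ (J + 1)) V} ≤
            ((gibbsK F ℰp γ K).map (descendTo F ℰp (J + 1) K hJK)).restrict {V | PlaqSmall (θBal F.L γ (c * b₀) p₀ (J + 1)) V}) :
    ∀ (L : ℕ), ∃ c₀ : ℝ, 0 < c₀ ∧ c₀ ≤ 1 ∧ ∀ (c : ℝ), 0 < c → c ≤ c₀ → ∃ pS : ℝ, ∀ (b₀ p₀ : ℝ), 0 < b₀ → pS ≤ p₀ → 0 < p₀ →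
      ∃ γ₁ : ℝ, 0 < γ₁ ∧ ∀ (F : T3Family) (γ : ℝ), F.L = L → 0 < γ → γ ≤ γ₁ →
        ∀ (J : ℕ), ∃ q : ℝ, 0 < q ∧ ∀ (K : ℕ) (hJK : J + 1 ≤ K)
          (B : Set (GaugeField (F.P J) 0 (Matrix.specialUnitaryGroup (Fin 2) ℂ))), MeasurableSet B →
            B ⊆ {U | PlaqSmall (θBal F.L γ (c * b₀) p₀ J) U} →
            ENNReal.ofReal q * gibbsK F ℰp γ K (descendTo F ℰp J K ((Nat.le_succ J).trans hJK) ⁻¹' B) ≤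
              gibbsK F ℰp γ K (descendTo F ℰp J K ((Nat.le_succ J).trans hJK) ⁻¹' B ∩
                descendTo F ℰp (J + 1) K hJK ⁻¹' {V | PlaqSmall (θBal F.L γ (c * b₀) p₀ (J + 1)) V}) :=
  oneLevelPersistenceIntCan_of_up_low_haarTubeRel hUL haarTubeRel_depthOne

end Summit.QuantumFields.YangMills.Theorems.FluctuationComparisonRegPrIntLPersistenceKFree

end
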